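import Summits.NavierStokesRegularity.NavierStokesRegularity.Theses.PalasekTowerBreakdown
import Summits.NavierStokesRegularity.FluidComputer.PalasekTowerOvershootFirstHitting
import Summits.NavierStokesRegularity.FluidComputer.PalasekTowerRegisterGlobalKatoWindow
import Summits.NavierStokesRegularity.FluidComputer.PalasekTowerRegisterGlobalStrainCeiling
import Summits.NavierStokesRegularity.FluidComputer.PalasekTowerRegisterGlobalEnvelopeAtHolds

/-!
# NavierStokesRegularity — route `PalasekTowerBreakdown`: the upper stub AT EVERY LEVEL `k ≥ 1` as one
# located event — `AprioriCeilingAt k` ⟺ «no LATE, STRAIN-CAPPED, pressure-driven FIRST OVERSHOOT of a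
# level in `(c₂Y_{k+1}, 2c₂Y_{k+1}]`» (lossless); the first rung `HeredityAtOne` and the level door of
# `HeredityFromTwo` re-typed through it

Supports `stmt-NavierStokesRegularity-19249` (`PalasekTowerBreakdown.HeredityAtOne`; registered skeleton v2
`Cruxes/HeredityAtOne/Lines/birth.lean` b90ab6bc703b9c77: stubs `stub_apriori_ceiling_at_one :
AprioriCeilingAt 1` / `stub_readout_floors_one : ReadoutFloorsAt 1`, holder of record `ns-blowup-ecbridge-1`)
and, through the level door `heredityFrom_iff_forall_apriori_and_floors` (p442648), its sibling
`stmt-NavierStokesRegularity-19250`. Cell `ns-blowup`, seat `ns-palasek-19250-p2` (g0; stub-worker on the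
UPPER stub of 19250 — nothing claimed on either item). Level-indexed twin of this seat's
`PalasekTowerBreakdownHeredityFromTwoFirstOvershoot.lean` (p453961, the `k ≥ 2` conjunction). LABEL: E–C
typing + kernel analysis (every statement PROVED; no `Prop` introduced; no named fact). WHAT THIS IS NOT:
not NS — no stage, flow or tower is constructed; no stub is decided; the theorems say EXACTLY what a
counterexample to `AprioriCeilingAt k` must exhibit, and conversely.

## What is proved

* `palasekTowerBreakdown_exists_aprioriCeilingAt_iff_noCappedFirstOvershootAt` — UNIVERSAL `c₀ > 0`
  (Leray's lifespan constant, `exists_norm_le_ceiling_of_kato_window`, p429305) and `C ≥ 0` (KNSS (4.6),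
  `Stage.exists_strainCeiling_continuation`, times `max(1, ε/(4c₀))²`) such that FOR EVERY `k ≥ 1`:
  `AprioriCeilingAt k` iff no finite-energy classical continuation `(u, p)` on `[0, T'] ⊆ [0, τ_{k+1}]` of
  a registered level-`k` stage of a pinned rigid quiet wide schedule (unit viscosity) FIRST reaches a level
  `L ∈ (c₂Y_{k+1}, 2c₂Y_{k+1}]` at a time `t₀ ∈ (τ_k, T']` with `t₀ ≥ τ_k + c₀/(c₂Y_k)²`, at a global
  argmax `x₀`, with `‖u‖ < L` on `[0, t₀) × ℝ³`, `0 ≤ ⟪u, ∂ₜu⟫`, `|Du|²_F + ⟪u, ∇p⟫ ≤ 0`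
  (`Stage.exists_firstOvershoot`, p442281), `⟪u, Du·v⟫ = 0`, and `‖∇u‖ ≤ C·L²` on
  `[τ_k + c₀/(c₂Y_k)², t₀] × ℝ³`. The constants do NOT depend on `k`.
* `palasekTowerBreakdown_aprioriCeilingAt_iff_noFirstOvershootAt` — the constant-free form (`k ≥ 1`).
* BY NAME: `palasekTowerBreakdown_heredityAtOne_iff_noFirstOvershootAt_one_and_floors`
  (`PalasekTowerBreakdown.HeredityAtOne ↔ «no first overshoot at level 1» ∧ ReadoutFloorsAt 1`, no
  hypothesis), `palasekTowerBreakdown_heredityAtOne_of_noFirstOvershootAt_one_floors`, the capped door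
  `palasekTowerBreakdown_exists_heredityAtOne_of_noCappedFirstOvershootAt_one_floors`, and the level door of
  the sibling `palasekTowerBreakdown_heredityFromTwo_iff_forall_noFirstOvershootAt_and_floors`
  (`PalasekTowerBreakdown.HeredityFromTwo ↔ ∀ k ≥ 2, «no first overshoot at level k» ∧ ReadoutFloorsAt k`).

Numbers of record at `k = 1` (item 19249, tree): the band is `((5/3)Y₂, (10/3)Y₂] ⊂ (10233, 20470]`
(`TowerRates.wide_Y_two_bounds`), lateness `t₀ − τ₁ ≥ c₀/((5/3)Y₁)²` with `(5/3)Y₁ ∈ (4630, 4632)`.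

References: S. Palasek, arXiv:2605.13827 §4 [cite: Palasek2026ElementaryModel, §4]; J. Leray, Acta
Math. 63 (1934) §21 (3.15) [cite: Leray1934, §21 (3.15) p. 226]; G. Koch, N. Nadirashvili, G. Seregin,
V. Šverák, Acta Math. 203 (2009), Prop. 4.1 with (4.6)
[cite: KochNadirashviliSereginSverak2009, Prop. 4.1 with (4.6), k = 1 (arXiv:0709.3599v1 p. 8)].
-/

-- `Summit.<Summit>.<Problem>` is the tree's mandated summit-side namespace (CONVENTIONS §2); for this
-- single-conjunct summit the two coincide, so the duplicate is deliberate.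
set_option linter.dupNamespace false

noncomputable section

namespace Summit.NavierStokesRegularity.NavierStokesRegularity.Theorems

open Set MeasureTheory Filter Topology Function Real
open scoped ENNReal ContDiff NNReal InnerProductSpace RealInnerProductSpace
open Literature.Analysis.FluidPDE
open Summit.NavierStokesRegularity.NavierStokesRegularity.Theses
open Summit.NavierStokesRegularity.FluidComputer.PalasekTowerClayBridge

/-! ## §1 Level `k ≥ 1`: the upper stub as one late, strain-capped, pressure-driven first-overshoot event -/

/-- **`AprioriCeilingAt k` ⟺ no LATE, STRAIN-CAPPED, pressure-driven FIRST OVERSHOOT at level `k`**, for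
every `k ≥ 1`, with constants `c₀ > 0`, `C ≥ 0` independent of `k` (see the module docstring).
[cite: Palasek2026ElementaryModel, §4] [cite: Leray1934, §21 (3.15) p. 226]
[cite: KochNadirashviliSereginSverak2009, Prop. 4.1 with (4.6), k = 1 (arXiv:0709.3599v1 p. 8)] -/
theorem palasekTowerBreakdown_exists_aprioriCeilingAt_iff_noCappedFirstOvershootAt :
    ∃ c₀ : ℝ, 0 < c₀ ∧ ∃ C : ℝ, 0 ≤ C ∧ ∀ k : ℕ, 1 ≤ k →
      (AprioriCeilingAt k ↔
        ∀ S : Schedule TowerRates.wide, S.Pins 8 (6 / 5) → S.Rigid → S.Quiet →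
        ∀ s : Stage 1 TowerRates.wide S (Margins.routeG TowerRates.wide) k,
        ∀ T' ∈ Icc (S.τ k) (S.τ (k + 1)),
        ∀ (u : ℝ → EuclideanSpace ℝ (Fin 3) → EuclideanSpace ℝ (Fin 3))
          (p : ℝ → EuclideanSpace ℝ (Fin 3) → ℝ),
          IsClassicalNSSolutionOn (Icc 0 T') 1 S.f u p →
          (∀ t ∈ Icc 0 (S.τ k), u t = s.u t ∧ p t = s.p t) →
          (∃ E : ℝ≥0∞, E < ⊤ ∧ ∀ t ∈ Icc 0 T', ∫⁻ x, ‖u t x‖ₑ ^ 2 ≤ E) →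
          ∀ L : ℝ, S.c₂ * TowerRates.wide.Y (k + 1) < L →
            L ≤ 2 * (S.c₂ * TowerRates.wide.Y (k + 1)) →
          ∀ t₀ ∈ Ioc (S.τ k) T', S.τ k + c₀ / (S.c₂ * TowerRates.wide.Y k) ^ 2 ≤ t₀ →
          ∀ x₀ : EuclideanSpace ℝ (Fin 3), ‖u t₀ x₀‖ = L → (∀ x, ‖u t₀ x‖ ≤ L) →
            (∀ t ∈ Ico 0 t₀, ∀ x, ‖u t x‖ < L) →
            0 ≤ ⟪u t₀ x₀, timeDerivWithin (Icc 0 T') u t₀ x₀⟫ →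
            frobeniusNormSq (fderiv ℝ (u t₀) x₀) + ⟪u t₀ x₀, gradient (p t₀) x₀⟫ ≤ 0 →
            (∀ v, ⟪u t₀ x₀, fderiv ℝ (u t₀) x₀ v⟫ = 0) →
            (∀ t ∈ Icc (S.τ k + c₀ / (S.c₂ * TowerRates.wide.Y k) ^ 2) t₀, ∀ x,
              ‖fderiv ℝ (u t) x‖ ≤ C * L ^ 2) →
            False) := by
  obtain ⟨c₀, hc₀, hK⟩ := exists_norm_le_ceiling_of_kato_window
  obtain ⟨ε, hε, C, hC, hS⟩ := Stage.exists_strainCeiling_continuation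
  set m : ℝ := max 1 (ε / (4 * c₀)) with hm
  have hm1 : 1 ≤ m := le_max_left _ _
  have hmε : ε / (4 * c₀) ≤ m := le_max_right _ _
  refine ⟨c₀, hc₀, C * m ^ 2, by positivity, fun k hk1 => ⟨?_, ?_⟩⟩
  · -- (⇒): a first overshoot of a level above the ceiling IS an overshoot
    intro hA S hP hR hQ s T' hT' u p hcl hagree hE L hBL _ t₀ ht₀ _ x₀ heq _ _ _ _ _ _
    have ht₀' : t₀ ∈ Icc 0 T' := ⟨((S.τ_pos k).trans ht₀.1).le, ht₀.2⟩
    have := hA S hP hR hQ s T' hT' u p hcl hagree hE t₀ ht₀' x₀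
    linarith
  · -- (⇐): an overshoot produces a late, capped, pressure-driven first overshoot
    intro h S hP hR hQ s T' hT' u p hcl hagree hE t ht x
    by_contra hgt
    have hgt' : S.c₂ * TowerRates.wide.Y (k + 1) < ‖u t x‖ := lt_of_not_ge hgt
    have hc₂ : 0 < S.c₂ := s.c₂_pos
    have hYk : 0 < TowerRates.wide.Y k := Real.rpow_pos_of_pos (TowerRates.wide.N_pos k) _
    have hA : 0 < S.c₂ * TowerRates.wide.Y k := mul_pos hc₂ hYk
    have hAB : S.c₂ * TowerRates.wide.Y k < S.c₂ * TowerRates.wide.Y (k + 1) :=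
      mul_lt_mul_of_pos_left (TowerRates.wide.Y_lt_Y_succ k) hc₂
    have hB : 0 < S.c₂ * TowerRates.wide.Y (k + 1) := hA.trans hAB
    have h2AB : 2 * (S.c₂ * TowerRates.wide.Y k) ≤ S.c₂ * TowerRates.wide.Y (k + 1) :=
      hR.two_mul_ceiling_le k
    set L : ℝ := min ‖u t x‖ (2 * (S.c₂ * TowerRates.wide.Y (k + 1))) with hLdef
    have hBL : S.c₂ * TowerRates.wide.Y (k + 1) < L := lt_min hgt' (by linarith)
    have hL2 : L ≤ 2 * (S.c₂ * TowerRates.wide.Y (k + 1)) := min_le_right _ _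
    have hL0 : 0 < L := hB.trans hBL
    have hAL : S.c₂ * TowerRates.wide.Y k < L := hAB.trans hBL
    have hL2A : 2 * (S.c₂ * TowerRates.wide.Y k) ≤ L := h2AB.trans hBL.le
    obtain ⟨t₀, ht₀, x₀, heq, hle, hstrict, htime, hineq⟩ :=
      s.exists_firstOvershoot one_pos hQ hk1 hT'.1 hcl (fun r hr => (hagree r hr).1) hE hAL
        ⟨t, ht, x, min_le_left _ _⟩
    rw [one_mul] at hineq
    have ht₀' : t₀ ∈ Icc 0 T' := ⟨((S.τ_pos k).trans ht₀.1).le, ht₀.2⟩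
    -- (i) lateness: the Kato/Leray start of the window is overshoot-free
    have hlate : S.τ k + c₀ / (S.c₂ * TowerRates.wide.Y k) ^ 2 ≤ t₀ := by
      by_contra hlt
      have hlt' : t₀ - S.τ k < c₀ / (S.c₂ * TowerRates.wide.Y k) ^ 2 := by
        linarith [lt_of_not_ge hlt]
      have := hK S hP hR hQ k hk1 s T' hT' u p hcl hagree hE t₀ ht₀' hlt' x₀
      linarith
    -- (ii) first-order condition at the global argmax
    have hmax : ∀ y, ‖u t₀ y‖ ≤ ‖u t₀ x₀‖ := fun y => by rw [heq]; exact hle y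
    have hfo : ∀ v, ⟪u t₀ x₀, fderiv ℝ (u t₀) x₀ v⟫ = 0 :=
      fun v => HittingCalculus.inner_fderiv_eq_zero_of_isMax hcl ht₀' hmax v
    -- (iii) the strain cap on the late part of the window up to the first overshoot
    have hδ : 0 < c₀ / (S.c₂ * TowerRates.wide.Y k) ^ 2 := div_pos hc₀ (pow_pos hA 2)
    have hcap : ∀ t' ∈ Icc (S.τ k + c₀ / (S.c₂ * TowerRates.wide.Y k) ^ 2) t₀, ∀ y,
        ‖fderiv ℝ (u t') y‖ ≤ C * m ^ 2 * L ^ 2 := by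
      intro t' ht' y
      have hτt' : S.τ k < t' := by linarith [ht'.1]
      have ht'T : t' ≤ T' := ht'.2.trans ht₀.2
      have ht'0 : 0 < t' := (S.τ_pos k).trans hτt'
      have hcl' : IsClassicalNSSolutionOn (Icc 0 t') 1 S.f u p :=
        hcl.mono (Icc_subset_Icc_right ht'T) (uniqueDiffOn_Icc ht'0)
      have hE' : ∃ E : ℝ≥0∞, E < ⊤ ∧ ∀ r ∈ Icc 0 t', ∫⁻ z, ‖u r z‖ₑ ^ 2 ≤ E := by
        obtain ⟨E, hEt, hEb⟩ := hE
        exact ⟨E, hEt, fun r hr => hEb r ⟨hr.1, hr.2.trans ht'T⟩⟩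
      have hbound : ∀ r ∈ Icc (S.τ k) t', ∀ z, ‖u r z‖ ≤ L * m := by
        intro r hr z
        have hrL : ‖u r z‖ ≤ L := by
          rcases lt_or_ge r t₀ with hlt | hge
          · exact (hstrict r ⟨(S.τ_pos k).le.trans hr.1, hlt⟩ z).le
          · have hr0 : r = t₀ := le_antisymm (hr.2.trans ht'.2) hge
            rw [hr0]
            exact hle z
        calc ‖u r z‖ ≤ L := hrL
          _ = L * 1 := (mul_one L).symm
          _ ≤ L * m := mul_le_mul_of_nonneg_left hm1 hL0.le
      have hεt : ε ≤ (L * m) ^ 2 * (t' - S.τ k) := by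
        have h1 : c₀ / (S.c₂ * TowerRates.wide.Y k) ^ 2 ≤ t' - S.τ k := by linarith [ht'.1]
        have h1' : c₀ ≤ (t' - S.τ k) * (S.c₂ * TowerRates.wide.Y k) ^ 2 :=
          (div_le_iff₀ (pow_pos hA 2)).1 h1
        have hdt : 0 ≤ t' - S.τ k := by linarith
        have h4 : 4 * (S.c₂ * TowerRates.wide.Y k) ^ 2 ≤ L ^ 2 := by
          have h := mul_le_mul hL2A hL2A (by positivity) hL0.le
          nlinarith [h]
        have h5a : 4 * (S.c₂ * TowerRates.wide.Y k) ^ 2 * (t' - S.τ k) ≤ L ^ 2 * (t' - S.τ k) :=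
          mul_le_mul_of_nonneg_right h4 hdt
        have h5 : 4 * c₀ ≤ L ^ 2 * (t' - S.τ k) := by linarith [h1', h5a]
        have h6 : ε ≤ 4 * c₀ * m := by
          have := (div_le_iff₀ (by positivity : (0 : ℝ) < 4 * c₀)).1 hmε
          linarith
        have h7 : m ≤ m ^ 2 := by nlinarith [hm1]
        calc ε ≤ 4 * c₀ * m := h6
          _ ≤ 4 * c₀ * m ^ 2 := mul_le_mul_of_nonneg_left h7 (by positivity)
          _ ≤ L ^ 2 * (t' - S.τ k) * m ^ 2 := mul_le_mul_of_nonneg_right h5 (sq_nonneg m)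
          _ = (L * m) ^ 2 * (t' - S.τ k) := by ring
      have key := hS hQ hk1 s hτt' hcl' (fun r hr => (hagree r hr).1) hE' hbound t'
        ⟨hτt'.le, le_rfl⟩ hεt y
      calc ‖fderiv ℝ (u t') y‖ ≤ C * (L * m) ^ 2 := key
        _ = C * m ^ 2 * L ^ 2 := by ring
    exact h S hP hR hQ s T' hT' u p hcl hagree hE L hBL hL2 t₀ ht₀ hlate x₀ heq hle hstrict
      htime hineq hfo hcap

/-- **`AprioriCeilingAt k` ⟺ no pressure-driven FIRST OVERSHOOT of a level in `(c₂Y_{k+1}, 2c₂Y_{k+1}]`**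
(`k ≥ 1`, constant-free form). [cite: Palasek2026ElementaryModel, §4] -/
theorem palasekTowerBreakdown_aprioriCeilingAt_iff_noFirstOvershootAt {k : ℕ} (hk : 1 ≤ k) :
    AprioriCeilingAt k ↔
      ∀ S : Schedule TowerRates.wide, S.Pins 8 (6 / 5) → S.Rigid → S.Quiet →
      ∀ s : Stage 1 TowerRates.wide S (Margins.routeG TowerRates.wide) k,
      ∀ T' ∈ Icc (S.τ k) (S.τ (k + 1)),
      ∀ (u : ℝ → EuclideanSpace ℝ (Fin 3) → EuclideanSpace ℝ (Fin 3))
        (p : ℝ → EuclideanSpace ℝ (Fin 3) → ℝ),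
        IsClassicalNSSolutionOn (Icc 0 T') 1 S.f u p →
        (∀ t ∈ Icc 0 (S.τ k), u t = s.u t ∧ p t = s.p t) →
        (∃ E : ℝ≥0∞, E < ⊤ ∧ ∀ t ∈ Icc 0 T', ∫⁻ x, ‖u t x‖ₑ ^ 2 ≤ E) →
        ∀ L : ℝ, S.c₂ * TowerRates.wide.Y (k + 1) < L →
          L ≤ 2 * (S.c₂ * TowerRates.wide.Y (k + 1)) →
        ∀ t₀ ∈ Ioc (S.τ k) T', ∀ x₀ : EuclideanSpace ℝ (Fin 3),
          ‖u t₀ x₀‖ = L → (∀ x, ‖u t₀ x‖ ≤ L) → (∀ t ∈ Ico 0 t₀, ∀ x, ‖u t x‖ < L) →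
          0 ≤ ⟪u t₀ x₀, timeDerivWithin (Icc 0 T') u t₀ x₀⟫ →
          frobeniusNormSq (fderiv ℝ (u t₀) x₀) + ⟪u t₀ x₀, gradient (p t₀) x₀⟫ ≤ 0 →
          (∀ v, ⟪u t₀ x₀, fderiv ℝ (u t₀) x₀ v⟫ = 0) → False := by
  obtain ⟨c₀, -, C, -, hiff⟩ :=
    palasekTowerBreakdown_exists_aprioriCeilingAt_iff_noCappedFirstOvershootAt
  refine ⟨fun hA => ?_, fun h => (hiff k hk).2 ?_⟩
  · intro S hP hR hQ s T' hT' u p hcl hagree hE L hBL _ t₀ ht₀ x₀ heq _ _ _ _ _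
    have ht₀' : t₀ ∈ Icc 0 T' := ⟨((S.τ_pos k).trans ht₀.1).le, ht₀.2⟩
    have := hA S hP hR hQ s T' hT' u p hcl hagree hE t₀ ht₀' x₀
    linarith
  · intro S hP hR hQ s T' hT' u p hcl hagree hE L hBL hL2 t₀ ht₀ _ x₀ heq hle hstrict htime hineq
      hfo _
    exact h S hP hR hQ s T' hT' u p hcl hagree hE L hBL hL2 t₀ ht₀ x₀ heq hle hstrict htime hineq hfo

/-! ## §2 By name: the first rung `PalasekTowerBreakdown.HeredityAtOne` (item 19249) -/

/-- **Item 19249 re-typed through the event (no hypothesis)**: `PalasekTowerBreakdown.HeredityAtOne ↔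
«no pressure-driven first overshoot of a level in ((5/3)Y₂, (10/3)Y₂] by a finite-energy classical
continuation of a registered level-1 stage» ∧ ReadoutFloorsAt 1`
(`heredityAtOne_iff_aprioriCeilingAt_and_readoutFloorsAt` + §1). [folklore] -/
theorem palasekTowerBreakdown_heredityAtOne_iff_noFirstOvershootAt_one_and_floors :
    PalasekTowerBreakdown.HeredityAtOne ↔
      (∀ S : Schedule TowerRates.wide, S.Pins 8 (6 / 5) → S.Rigid → S.Quiet →
      ∀ s : Stage 1 TowerRates.wide S (Margins.routeG TowerRates.wide) 1,
      ∀ T' ∈ Icc (S.τ 1) (S.τ (1 + 1)),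
      ∀ (u : ℝ → EuclideanSpace ℝ (Fin 3) → EuclideanSpace ℝ (Fin 3))
        (p : ℝ → EuclideanSpace ℝ (Fin 3) → ℝ),
        IsClassicalNSSolutionOn (Icc 0 T') 1 S.f u p →
        (∀ t ∈ Icc 0 (S.τ 1), u t = s.u t ∧ p t = s.p t) →
        (∃ E : ℝ≥0∞, E < ⊤ ∧ ∀ t ∈ Icc 0 T', ∫⁻ x, ‖u t x‖ₑ ^ 2 ≤ E) →
        ∀ L : ℝ, S.c₂ * TowerRates.wide.Y (1 + 1) < L →
          L ≤ 2 * (S.c₂ * TowerRates.wide.Y (1 + 1)) →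
        ∀ t₀ ∈ Ioc (S.τ 1) T', ∀ x₀ : EuclideanSpace ℝ (Fin 3),
          ‖u t₀ x₀‖ = L → (∀ x, ‖u t₀ x‖ ≤ L) → (∀ t ∈ Ico 0 t₀, ∀ x, ‖u t x‖ < L) →
          0 ≤ ⟪u t₀ x₀, timeDerivWithin (Icc 0 T') u t₀ x₀⟫ →
          frobeniusNormSq (fderiv ℝ (u t₀) x₀) + ⟪u t₀ x₀, gradient (p t₀) x₀⟫ ≤ 0 →
          (∀ v, ⟪u t₀ x₀, fderiv ℝ (u t₀) x₀ v⟫ = 0) → False) ∧ ReadoutFloorsAt 1 :=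
  heredityAtOne_iff_aprioriCeilingAt_and_readoutFloorsAt.trans
    (and_congr_left' (palasekTowerBreakdown_aprioriCeilingAt_iff_noFirstOvershootAt le_rfl))

/-- **The composition concluding item 19249 BY NAME** from the event form of its upper stub and its
registered lower stub `ReadoutFloorsAt 1`. [folklore] -/
theorem palasekTowerBreakdown_heredityAtOne_of_noFirstOvershootAt_one_floors
    (hA : ∀ S : Schedule TowerRates.wide, S.Pins 8 (6 / 5) → S.Rigid → S.Quiet →
      ∀ s : Stage 1 TowerRates.wide S (Margins.routeG TowerRates.wide) 1,
      ∀ T' ∈ Icc (S.τ 1) (S.τ (1 + 1)),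
      ∀ (u : ℝ → EuclideanSpace ℝ (Fin 3) → EuclideanSpace ℝ (Fin 3))
        (p : ℝ → EuclideanSpace ℝ (Fin 3) → ℝ),
        IsClassicalNSSolutionOn (Icc 0 T') 1 S.f u p →
        (∀ t ∈ Icc 0 (S.τ 1), u t = s.u t ∧ p t = s.p t) →
        (∃ E : ℝ≥0∞, E < ⊤ ∧ ∀ t ∈ Icc 0 T', ∫⁻ x, ‖u t x‖ₑ ^ 2 ≤ E) →
        ∀ L : ℝ, S.c₂ * TowerRates.wide.Y (1 + 1) < L →
          L ≤ 2 * (S.c₂ * TowerRates.wide.Y (1 + 1)) →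
        ∀ t₀ ∈ Ioc (S.τ 1) T', ∀ x₀ : EuclideanSpace ℝ (Fin 3),
          ‖u t₀ x₀‖ = L → (∀ x, ‖u t₀ x‖ ≤ L) → (∀ t ∈ Ico 0 t₀, ∀ x, ‖u t x‖ < L) →
          0 ≤ ⟪u t₀ x₀, timeDerivWithin (Icc 0 T') u t₀ x₀⟫ →
          frobeniusNormSq (fderiv ℝ (u t₀) x₀) + ⟪u t₀ x₀, gradient (p t₀) x₀⟫ ≤ 0 →
          (∀ v, ⟪u t₀ x₀, fderiv ℝ (u t₀) x₀ v⟫ = 0) → False)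
    (hB : ReadoutFloorsAt 1) : PalasekTowerBreakdown.HeredityAtOne :=
  palasekTowerBreakdown_heredityAtOne_iff_noFirstOvershootAt_one_and_floors.2 ⟨hA, hB⟩

/-- **The capped door to item 19249**: universal `c₀ > 0`, `C ≥ 0` such that excluding LATE
(`t₀ ≥ τ₁ + c₀/((5/3)Y₁)²`), STRAIN-CAPPED (`‖∇u‖ ≤ C·L²` on `[τ₁ + c₀/((5/3)Y₁)², t₀] × ℝ³`),
pressure-driven first overshoots of levels `L ∈ ((5/3)Y₂, (10/3)Y₂]` by finite-energy classical
continuations of registered level-1 stages, together with `ReadoutFloorsAt 1`, proves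
`PalasekTowerBreakdown.HeredityAtOne`. [cite: Leray1934, §21 (3.15) p. 226]
[cite: KochNadirashviliSereginSverak2009, Prop. 4.1 with (4.6), k = 1 (arXiv:0709.3599v1 p. 8)] -/
theorem palasekTowerBreakdown_exists_heredityAtOne_of_noCappedFirstOvershootAt_one_floors :
    ∃ c₀ : ℝ, 0 < c₀ ∧ ∃ C : ℝ, 0 ≤ C ∧
      ((∀ S : Schedule TowerRates.wide, S.Pins 8 (6 / 5) → S.Rigid → S.Quiet →
        ∀ s : Stage 1 TowerRates.wide S (Margins.routeG TowerRates.wide) 1,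
        ∀ T' ∈ Icc (S.τ 1) (S.τ (1 + 1)),
        ∀ (u : ℝ → EuclideanSpace ℝ (Fin 3) → EuclideanSpace ℝ (Fin 3))
          (p : ℝ → EuclideanSpace ℝ (Fin 3) → ℝ),
          IsClassicalNSSolutionOn (Icc 0 T') 1 S.f u p →
          (∀ t ∈ Icc 0 (S.τ 1), u t = s.u t ∧ p t = s.p t) →
          (∃ E : ℝ≥0∞, E < ⊤ ∧ ∀ t ∈ Icc 0 T', ∫⁻ x, ‖u t x‖ₑ ^ 2 ≤ E) →
          ∀ L : ℝ, S.c₂ * TowerRates.wide.Y (1 + 1) < L →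
            L ≤ 2 * (S.c₂ * TowerRates.wide.Y (1 + 1)) →
          ∀ t₀ ∈ Ioc (S.τ 1) T', S.τ 1 + c₀ / (S.c₂ * TowerRates.wide.Y 1) ^ 2 ≤ t₀ →
          ∀ x₀ : EuclideanSpace ℝ (Fin 3), ‖u t₀ x₀‖ = L → (∀ x, ‖u t₀ x‖ ≤ L) →
            (∀ t ∈ Ico 0 t₀, ∀ x, ‖u t x‖ < L) →
            0 ≤ ⟪u t₀ x₀, timeDerivWithin (Icc 0 T') u t₀ x₀⟫ →
            frobeniusNormSq (fderiv ℝ (u t₀) x₀) + ⟪u t₀ x₀, gradient (p t₀) x₀⟫ ≤ 0 →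
            (∀ v, ⟪u t₀ x₀, fderiv ℝ (u t₀) x₀ v⟫ = 0) →
            (∀ t ∈ Icc (S.τ 1 + c₀ / (S.c₂ * TowerRates.wide.Y 1) ^ 2) t₀, ∀ x,
              ‖fderiv ℝ (u t) x‖ ≤ C * L ^ 2) →
            False) →
        ReadoutFloorsAt 1 → PalasekTowerBreakdown.HeredityAtOne) := by
  obtain ⟨c₀, hc₀, C, hC, hiff⟩ :=
    palasekTowerBreakdown_exists_aprioriCeilingAt_iff_noCappedFirstOvershootAt
  exact ⟨c₀, hc₀, C, hC, fun hA hB =>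
    heredityAtOne_of_aprioriCeilingAt_readoutFloorsAt ((hiff 1 le_rfl).2 hA) hB⟩

/-! ## §3 By name: the level door of the sibling `PalasekTowerBreakdown.HeredityFromTwo` (item 19250) -/

/-- **The child crux `HeredityFromTwo` level by level through the event (no hypothesis)**:
`PalasekTowerBreakdown.HeredityFromTwo ↔ ∀ k ≥ 2, «no pressure-driven first overshoot at level k» ∧
ReadoutFloorsAt k` (`heredityFrom_iff_forall_apriori_and_floors`, p442648, + §1) — a worker or disprover
may attack ONE level `k ≥ 2` by name. [folklore] -/
theorem palasekTowerBreakdown_heredityFromTwo_iff_forall_noFirstOvershootAt_and_floors :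
    PalasekTowerBreakdown.HeredityFromTwo ↔ ∀ k : ℕ, 2 ≤ k →
      (∀ S : Schedule TowerRates.wide, S.Pins 8 (6 / 5) → S.Rigid → S.Quiet →
      ∀ s : Stage 1 TowerRates.wide S (Margins.routeG TowerRates.wide) k,
      ∀ T' ∈ Icc (S.τ k) (S.τ (k + 1)),
      ∀ (u : ℝ → EuclideanSpace ℝ (Fin 3) → EuclideanSpace ℝ (Fin 3))
        (p : ℝ → EuclideanSpace ℝ (Fin 3) → ℝ),
        IsClassicalNSSolutionOn (Icc 0 T') 1 S.f u p →
        (∀ t ∈ Icc 0 (S.τ k), u t = s.u t ∧ p t = s.p t) →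
        (∃ E : ℝ≥0∞, E < ⊤ ∧ ∀ t ∈ Icc 0 T', ∫⁻ x, ‖u t x‖ₑ ^ 2 ≤ E) →
        ∀ L : ℝ, S.c₂ * TowerRates.wide.Y (k + 1) < L →
          L ≤ 2 * (S.c₂ * TowerRates.wide.Y (k + 1)) →
        ∀ t₀ ∈ Ioc (S.τ k) T', ∀ x₀ : EuclideanSpace ℝ (Fin 3),
          ‖u t₀ x₀‖ = L → (∀ x, ‖u t₀ x‖ ≤ L) → (∀ t ∈ Ico 0 t₀, ∀ x, ‖u t x‖ < L) →
          0 ≤ ⟪u t₀ x₀, timeDerivWithin (Icc 0 T') u t₀ x₀⟫ →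
          frobeniusNormSq (fderiv ℝ (u t₀) x₀) + ⟪u t₀ x₀, gradient (p t₀) x₀⟫ ≤ 0 →
          (∀ v, ⟪u t₀ x₀, fderiv ℝ (u t₀) x₀ v⟫ = 0) → False) ∧ ReadoutFloorsAt k := by
  refine (heredityFrom_iff_forall_apriori_and_floors (by norm_num : 1 ≤ 2)).trans ?_
  refine forall_congr' fun k => forall_congr' fun hk => ?_
  exact and_congr_left' (palasekTowerBreakdown_aprioriCeilingAt_iff_noFirstOvershootAt
    (le_trans one_le_two hk))

end Summit.NavierStokesRegularity.NavierStokesRegularity.Theorems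

end
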